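import Summits.CriticalPhenomena.PercolationContinuityZ3.Theorems.PercNearOneGluingNoHeavyLowerTailOneCutFiveZeroOneHalf
import Mathlib.Tactic.Linarith
import HarnessLib

/-!
# `NoHeavyLowerTail` (stmt-CriticalPhenomena-4575), |A| = 5 glued rung: the pocket exchange holds in the UNION-BOUND regime
# `q_b + q_c ≥ 1 + q_a` — hence `Z(3,2)` (`OneCutFive.ZeroOneThree`) holds whenever the weakest vertex has `q_a ≤ ½`

Support file (prover seat `prim-ineq-gen-8`, gen 7; `--supports stmt-CriticalPhenomena-4575`).  No definitions, no named facts, no sorries.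
Context (memo `run/shared/lean/prim/prim-ineq-gen-8/FINDING-gen7-CORE.md` §7): the `½`-threshold pocket rows (POCKET-½, Zmax, V3MAX) are FALSE
(`…OneCutFivePocketHalfRefutation`); the surviving four-point row behind the glued half of oneCut(5) is `Z(3,2)` (`Σ q > 2`).  This file records
the elementary part of `Z(3,2)` that needs no correlation inequality at all:

* `OneCutFive.pocketExchange_of_pair_sum` — for distinct `a, b, c` (any weights): if `μ(o↔b) + μ(o↔c) ≥ 1 + μ(o↔a)` then
  `μ(B = {a}) ≤ μ(B = {b,c})`.  Proof: `μ(B={a}) + μ(o↔a,b,c) ≤ μ(o↔a)` and `μ(B={b,c}) + μ(o↔a,b,c) = μ(o↔b, o↔c) ≥ μ(o↔b) + μ(o↔c) − 1`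
  (inclusion–exclusion).
* `OneCutFive.pocketExchange_of_sum_gt_two_of_le_half` — hence under the `Z(3,2)` hypothesis `q_a + q_b + q_c > 2`, the exchange at `a` holds as
  soon as `q_a ≤ ½` (then `q_b + q_c > 2 − q_a ≥ 1 + q_a`).
So the open content of `Z(3,2)` is the regime `q_a > ½`, `q_b + q_c < 1 + q_a` (all three reliabilities close to one another, e.g. `(0.7, 0.7, 0.7)`);
`Z(3,2)` is tight on the family `b = c glued, q_a = q_b` (margin exactly `q_b − q_a`), where no second-order perturbation produced a violation (memo §7).
-/

noncomputable section

namespace Summit.CriticalPhenomena.PercolationContinuityZ3.Theorems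

open MeasureTheory Set Literature.Probability.LatticeModels Literature.Probability.Percolation
open scoped Classical BigOperators

namespace OneCutFive

variable {n : ℕ}

/-- **The pocket exchange in the union-bound regime.**  For any finite weighted graph and vertices `o, a, b, c`:
if `μ(o↔b) + μ(o↔c) ≥ 1 + μ(o↔a)` then `μ(o↔a, o↮b, o↮c) ≤ μ(o↮a, o↔b, o↔c)`.  (No thresholds, no correlation inequality:
`s_a + μ(abc) ≤ q_a` and `d_bc + μ(abc) = μ(o↔b ∧ o↔c) ≥ q_b + q_c − 1`.) [this work] -/
theorem pocketExchange_of_pair_sum (w : Sym2 (Fin n) → unitInterval) (o a b c : Fin n)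
    (h : 1 + (prodBernoulli w).real (openConn o a) ≤ (prodBernoulli w).real (openConn o b) + (prodBernoulli w).real (openConn o c)) :
    (prodBernoulli w).real {ω : BondConfig (Fin n) | ω ∈ openConn o a ∧ ω ∉ openConn o b ∧ ω ∉ openConn o c} ≤
      (prodBernoulli w).real {ω : BondConfig (Fin n) | ω ∉ openConn o a ∧ ω ∈ openConn o b ∧ ω ∈ openConn o c} := by
  set μ := prodBernoulli w with hμ
  have hmeas : ∀ s : Set (BondConfig (Fin n)), MeasurableSet s := fun _ => MeasurableSet.of_discrete
  set A : Set (BondConfig (Fin n)) := openConn o a with hA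
  set B : Set (BondConfig (Fin n)) := openConn o b with hB
  set C : Set (BondConfig (Fin n)) := openConn o c with hC
  set Sa : Set (BondConfig (Fin n)) := {ω | ω ∈ A ∧ ω ∉ B ∧ ω ∉ C} with hSa
  set Dbc : Set (BondConfig (Fin n)) := {ω | ω ∉ A ∧ ω ∈ B ∧ ω ∈ C} with hDbc
  set F : Set (BondConfig (Fin n)) := A ∩ (B ∩ C) with hF
  -- `s_a + μ(abc) ≤ q_a`
  have h1 : μ.real Sa + μ.real F ≤ μ.real A := by
    have hdisj : Disjoint Sa F := by
      rw [Set.disjoint_left]; rintro ω ⟨_, hb, _⟩ ⟨_, hb', _⟩; exact hb hb'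
    have hsub : Sa ∪ F ⊆ A := by
      rintro ω (⟨ha, _, _⟩ | ⟨ha, _⟩) <;> exact ha
    rw [← measureReal_union hdisj (hmeas F)]
    exact measureReal_mono hsub
  -- `d_bc + μ(abc) = μ(B ∩ C)`
  have h2 : μ.real Dbc + μ.real F = μ.real (B ∩ C) := by
    have hdisj : Disjoint Dbc F := by
      rw [Set.disjoint_left]; rintro ω ⟨ha, _, _⟩ ⟨ha', _⟩; exact ha ha'
    have hunion : Dbc ∪ F = B ∩ C := by
      ext ω; simp only [hDbc, hF, mem_union, mem_setOf_eq, mem_inter_iff]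
      constructor
      · rintro (⟨_, hb, hc⟩ | ⟨_, hb, hc⟩) <;> exact ⟨hb, hc⟩
      · rintro ⟨hb, hc⟩
        by_cases ha : ω ∈ A
        · exact Or.inr ⟨ha, hb, hc⟩
        · exact Or.inl ⟨ha, hb, hc⟩
    rw [← measureReal_union hdisj (hmeas F), hunion]
  -- inclusion–exclusion: `μ(B ∩ C) ≥ μ B + μ C − 1`
  have h3 : μ.real B + μ.real C ≤ 1 + μ.real (B ∩ C) := by
    have hie : μ.real (B ∪ C) + μ.real (B ∩ C) = μ.real B + μ.real C := measureReal_union_add_inter (hmeas C)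
    have hle : μ.real (B ∪ C) ≤ 1 := measureReal_le_one
    linarith
  linarith

/-- **`Z(3,2)` when the weakest vertex is at most half-reliable.**  If `q_a + q_b + q_c > 2` and `q_a ≤ ½` then
`μ(B = {a}) ≤ μ(B = {b,c})` (indeed `q_b + q_c > 2 − q_a ≥ 1 + q_a`).  [this work] -/
theorem pocketExchange_of_sum_gt_two_of_le_half (w : Sym2 (Fin n) → unitInterval) (o a b c : Fin n)
    (hsum : 2 < (prodBernoulli w).real (openConn o a) + (prodBernoulli w).real (openConn o b) +
      (prodBernoulli w).real (openConn o c))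
    (hhalf : (prodBernoulli w).real (openConn o a) ≤ 1 / 2) :
    (prodBernoulli w).real {ω : BondConfig (Fin n) | ω ∈ openConn o a ∧ ω ∉ openConn o b ∧ ω ∉ openConn o c} ≤
      (prodBernoulli w).real {ω : BondConfig (Fin n) | ω ∉ openConn o a ∧ ω ∈ openConn o b ∧ ω ∈ openConn o c} :=
  pocketExchange_of_pair_sum w o a b c (by linarith)

/-- **`Z(3,2)` when the two stronger vertices are jointly reliable**: if `q_a + q_b + q_c > 2`, `a` is the weakest and
`q_b + q_c ≥ 1 + q_a`, the `Z(3,2)` conclusion `μ{o reaches ≤ 1 of a,b,c} ≤ t` holds for every `t ≥ 1 − q_a` (via the tree's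
`pocket ⟹ Z(3,2)` bookkeeping, here inlined for the triple).  Equivalently: the open part of `ZeroOneThree` is the regime
`q_b + q_c < 1 + q_a` (which forces `q_a > ½`). [this work] -/
theorem le_one_reached_le_of_pair_sum (w : Sym2 (Fin n) → unitInterval) (R : Finset (Fin n)) (o a b c : Fin n) (t : ℝ)
    (hR : R = {a, b, c}) (hab : a ≠ b) (hac : a ≠ c) (hbc : b ≠ c)
    (h : 1 + (prodBernoulli w).real (openConn o a) ≤ (prodBernoulli w).real (openConn o b) + (prodBernoulli w).real (openConn o c))
    (ht : (prodBernoulli w).real (openConn o a)ᶜ ≤ t) :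
    (prodBernoulli w).real {ω : BondConfig (Fin n) | (R.filter fun v => ω ∈ openConn o v).card ≤ 1} ≤ t := by
  have hP := pocketExchange_of_pair_sum w o a b c h
  have ha : a ∈ R := by simp [hR]
  have hb : b ∈ R := by simp [hR]
  have hc : c ∈ R := by simp [hR]
  exact (measureReal_le_one_le_compl_of_exchange w R o a b c ha hb hc hab hac hbc hP).trans ht

end OneCutFive

end Summit.CriticalPhenomena.PercolationContinuityZ3.Theorems
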